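import Literature.Analysis.FluidPDE.OseenSliceHolderSeminorm
import Mathlib.MeasureTheory.Integral.IntervalIntegral.Periodic

/-!
# `stub_cellOscSlice` of line `vanishing-cell-reynolds` (crux HelicalEndLiouville, stmt-NavierStokesRegularity-14062) —
# positive evidence by the drefute seat (a prover may land it)

The lead's registered stub `stub_cellOscSlice` (skeleton d4c7fc4e), VERBATIM as `CellOscSlice`: from the Oseen
cell-oscillation gap with constant `κ` (both data slots bounded by sup norms) to the LINEAR-in-the-oscillation bound
`‖osc N_σ[f,f]‖ ≤ K·min(σ^{-1/2}, ‖L‖²σ^{-3/2})·M·S` with `K = max (4κ) 1`: split `f = p + w`, `p = Π₀f` the cell mean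
(line-invariant because `f` is `L`-periodic), `w = f − p` (`‖w‖ ≤ S`, `‖w‖ ≤ 2M`); bilinearity of the slice;
`osc N[p,p] = 0`; the three remaining terms cost `κ·M·S`, `κ·S·M`, `κ·(2M)·S`.
-/

noncomputable section
set_option linter.dupNamespace false
open MeasureTheory Set intervalIntegral Literature.Analysis.FluidPDE
open scoped ENNReal

namespace Summit.NavierStokesRegularity.NavierStokesRegularity.Cruxes.HelicalEndLiouville.DRefute

/-- `ℝ³`. -/
abbrev E3 : Type := EuclideanSpace ℝ (Fin 3)

/-- The Oseen cell-oscillation gap with constant `κ` (hypothesis of the stub; conclusion of `stub_cellGaps`). -/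
def OscGap (κ : ℝ) : Prop :=
  ∀ (L : E3) (f g : E3 → E3) (Mf Mg σ : ℝ), Continuous f → Continuous g → (∀ x, f (x + L) = f x) → (∀ x, g (x + L) = g x) → (∀ x, ‖f x‖ ≤ Mf) → (∀ x, ‖g x‖ ≤ Mg) → 0 < σ → ∀ x : E3, ‖oseenSlice σ f g x - ∫ r in (0:ℝ)..1, oseenSlice σ f g (x + r • L)‖ ≤ κ * min (σ ^ (-(1 / 2 : ℝ))) (‖L‖ ^ 2 * σ ^ (-(3 / 2 : ℝ))) * Mf * Mg

/-- VERBATIM copy of the lead's registered `stub_cellOscSlice` (skeleton d4c7fc4e). -/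
def CellOscSlice : Prop :=
  ∀ κ : ℝ, (∀ (L : E3) (f g : E3 → E3) (Mf Mg σ : ℝ), Continuous f → Continuous g → (∀ x, f (x + L) = f x) → (∀ x, g (x + L) = g x) → (∀ x, ‖f x‖ ≤ Mf) → (∀ x, ‖g x‖ ≤ Mg) → 0 < σ → ∀ x : E3, ‖oseenSlice σ f g x - ∫ r in (0:ℝ)..1, oseenSlice σ f g (x + r • L)‖ ≤ κ * min (σ ^ (-(1 / 2 : ℝ))) (‖L‖ ^ 2 * σ ^ (-(3 / 2 : ℝ))) * Mf * Mg) → ∃ K : ℝ, 0 < K ∧ ∀ (L : E3) (f : E3 → E3) (M S σ : ℝ), Continuous f → (∀ x, f (x + L) = f x) → (∀ x, ‖f x‖ ≤ M) → (∀ x, ‖f x - ∫ r in (0:ℝ)..1, f (x + r • L)‖ ≤ S) → 0 < σ → ∀ x : E3, ‖oseenSlice σ f f x - ∫ r in (0:ℝ)..1, oseenSlice σ f f (x + r • L)‖ ≤ K * min (σ ^ (-(1 / 2 : ℝ))) (‖L‖ ^ 2 * σ ^ (-(3 / 2 : ℝ))) * M * S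

/-! ### The cell mean of a continuous periodic field -/

section CellMean

variable {f : E3 → E3} {L : E3}

/-- Continuity of the cell mean `x ↦ ∫₀¹ f (x + r • L) dr`. -/
theorem continuous_cellMean (hf : Continuous f) : Continuous fun x : E3 => ∫ r in (0:ℝ)..1, f (x + r • L) := by
  have hu : Continuous (Function.uncurry fun (x : E3) (r : ℝ) => f (x + r • L)) := by
    change Continuous fun p : E3 × ℝ => f (p.1 + p.2 • L)
    fun_prop
  exact intervalIntegral.continuous_parametric_intervalIntegral_of_continuous' hu 0 1

/-- Sup bound of the cell mean. -/
theorem norm_cellMean_le {M : ℝ} (hM : ∀ x, ‖f x‖ ≤ M) (x : E3) : ‖∫ r in (0:ℝ)..1, f (x + r • L)‖ ≤ M := by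
  have := norm_integral_le_of_norm_le_const (a := (0:ℝ)) (b := 1) (C := M) (f := fun r => f (x + r • L))
    (fun r _ => hM _)
  simpa using this

/-- **Line invariance of the cell mean of an `L`-periodic field**: a shifted period has the same mean. -/
theorem cellMean_add_smul (hper : ∀ x, f (x + L) = f x) (x : E3) (s : ℝ) :
    (∫ r in (0:ℝ)..1, f (x + s • L + r • L)) = ∫ r in (0:ℝ)..1, f (x + r • L) := by
  have hp : Function.Periodic (fun r : ℝ => f (x + r • L)) 1 := fun r => by
    simp only [add_smul, one_smul, ← add_assoc, hper]
  have e : (fun r : ℝ => f (x + s • L + r • L)) = fun r => (fun r' : ℝ => f (x + r' • L)) (r + s) := by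
    funext r
    simp only [add_smul]
    congr 1
    abel
  rw [e, intervalIntegral.integral_comp_add_right (fun r' : ℝ => f (x + r' • L)) s, zero_add]
  have key := hp.intervalIntegral_add_eq s 0
  rw [zero_add] at key
  rw [show (1:ℝ) + s = s + 1 from add_comm 1 s]
  exact key

end CellMean

/-! ### The stub -/

/-- **`stub_cellOscSlice` holds**, with `K = max (4κ) 1`. -/
theorem cellOscSlice : CellOscSlice := by
  intro κ hκ
  refine ⟨max (4 * κ) 1, lt_max_of_lt_right one_pos, ?_⟩
  intro L f M S σ hf hper hM hS hσ x
  -- the split f = p + w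
  set p : E3 → E3 := fun y => ∫ r in (0:ℝ)..1, f (y + r • L) with hpdef
  set w : E3 → E3 := fun y => f y - p y with hwdef
  have hM0 : 0 ≤ M := (norm_nonneg _).trans (hM 0)
  have hS0 : 0 ≤ S := (norm_nonneg _).trans (hS 0)
  have hpc : Continuous p := continuous_cellMean hf
  have hwc : Continuous w := hf.sub hpc
  have hp_inv : ∀ (y : E3) (s : ℝ), p (y + s • L) = p y := fun y s => cellMean_add_smul hper y s
  have hp_per : ∀ y, p (y + L) = p y := fun y => by simpa using hp_inv y 1
  have hw_per : ∀ y, w (y + L) = w y := fun y => by simp only [hwdef, hper, hp_per]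
  have hpM : ∀ y, ‖p y‖ ≤ M := fun y => norm_cellMean_le hM y
  have hwS : ∀ y, ‖w y‖ ≤ S := fun y => hS y
  have hw2M : ∀ y, ‖w y‖ ≤ M + M := fun y =>
    (norm_sub_le _ _).trans (add_le_add (hM y) (hpM y))
  have hfpw : f = p + w := by funext y; simp [hwdef]
  -- integrability of the four slice integrands at every point
  have hI : ∀ (a b : E3 → E3) (Ma Mb : ℝ), Continuous a → Continuous b → (∀ y, ‖a y‖ ≤ Ma) →
      (∀ y, ‖b y‖ ≤ Mb) → ∀ y, Integrable (fun z => oseenKernel σ (y - z) (a z) (b z)) volume :=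
    fun a b Ma Mb ha hb hMa hMb y =>
      integrable_oseenKernel_slice_of_bound hσ ha.aestronglyMeasurable hb.aestronglyMeasurable hMa hMb y
  -- bilinear split, pointwise
  have hsplit : ∀ y, oseenSlice σ f f y =
      oseenSlice σ p p y + oseenSlice σ p w y + (oseenSlice σ w p y + oseenSlice σ w w y) := by
    intro y
    rw [hfpw, oseenSlice_add_left, oseenSlice_add_right (hI p p M M hpc hpc hpM hpM y)
      (hI p w M S hpc hwc hpM hwS y), oseenSlice_add_right (hI w p S M hwc hpc hwS hpM y)
      (hI w w S S hwc hwc hwS hwS y)]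
    · -- integrability of the `p ⊗ (p + w)` integrand
      have e : (fun z => oseenKernel σ (y - z) (p z) ((p + w) z)) =
          fun z => oseenKernel σ (y - z) (p z) (p z) + oseenKernel σ (y - z) (p z) (w z) := by
        funext z; simp only [Pi.add_apply, oseenKernel_add_right]
      rw [e]
      exact (hI p p M M hpc hpc hpM hpM y).add (hI p w M S hpc hwc hpM hwS y)
    · have e : (fun z => oseenKernel σ (y - z) (w z) ((p + w) z)) =
          fun z => oseenKernel σ (y - z) (w z) (p z) + oseenKernel σ (y - z) (w z) (w z) := by
        funext z; simp only [Pi.add_apply, oseenKernel_add_right]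
      rw [e]
      exact (hI w p S M hwc hpc hwS hpM y).add (hI w w S S hwc hwc hwS hwS y)
  -- continuity of the slices (for interval integrability along the segment)
  have hNc : ∀ (a b : E3 → E3) (Ma Mb : ℝ), Continuous a → Continuous b → (∀ y, ‖a y‖ ≤ Ma) →
      (∀ y, ‖b y‖ ≤ Mb) → Continuous (oseenSlice σ a b) := fun a b Ma Mb ha hb hMa hMb =>
    (contDiff_oseenSlice (n := 0) hσ ha.measurable hb.measurable hMa hMb).continuous
  have hint : ∀ (a b : E3 → E3) (Ma Mb : ℝ), Continuous a → Continuous b → (∀ y, ‖a y‖ ≤ Ma) →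
      (∀ y, ‖b y‖ ≤ Mb) → IntervalIntegrable (fun r : ℝ => oseenSlice σ a b (x + r • L)) volume 0 1 :=
    fun a b Ma Mb ha hb hMa hMb =>
      ((hNc a b Ma Mb ha hb hMa hMb).comp (by fun_prop : Continuous fun r : ℝ => x + r • L)).intervalIntegrable 0 1
  -- the oscillation of N[p,p] vanishes
  have hpp : oseenSlice σ p p x - ∫ r in (0:ℝ)..1, oseenSlice σ p p (x + r • L) = 0 := by
    have e : ∀ r : ℝ, oseenSlice σ p p (x + r • L) = oseenSlice σ p p x := by
      intro r
      rw [← oseenSlice_comp_add_right σ p p (r • L) x]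
      have ep : (fun y => p (y + r • L)) = p := funext fun y => hp_inv y r
      rw [ep]
    simp_rw [e]
    rw [intervalIntegral.integral_const]
    simp
  -- the three gapped terms
  have h1 := hκ L p w M S σ hpc hwc hp_per hw_per hpM hwS hσ x
  have h2 := hκ L w p S M σ hwc hpc hw_per hp_per hwS hpM hσ x
  have h3 := hκ L w w (M + M) S σ hwc hwc hw_per hw_per hw2M hwS hσ x
  set m : ℝ := min (σ ^ (-(1 / 2 : ℝ))) (‖L‖ ^ 2 * σ ^ (-(3 / 2 : ℝ))) with hm
  have hm0 : 0 ≤ m := le_min (Real.rpow_nonneg hσ.le _) (mul_nonneg (sq_nonneg _) (Real.rpow_nonneg hσ.le _))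
  -- assemble the oscillation of N[f,f]
  have hosc : oseenSlice σ f f x - ∫ r in (0:ℝ)..1, oseenSlice σ f f (x + r • L) =
      (oseenSlice σ p p x - ∫ r in (0:ℝ)..1, oseenSlice σ p p (x + r • L)) +
      (oseenSlice σ p w x - ∫ r in (0:ℝ)..1, oseenSlice σ p w (x + r • L)) +
      ((oseenSlice σ w p x - ∫ r in (0:ℝ)..1, oseenSlice σ w p (x + r • L)) +
       (oseenSlice σ w w x - ∫ r in (0:ℝ)..1, oseenSlice σ w w (x + r • L))) := by
    have e : (fun r : ℝ => oseenSlice σ f f (x + r • L)) = fun r =>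
        (oseenSlice σ p p (x + r • L) + oseenSlice σ p w (x + r • L)) +
        (oseenSlice σ w p (x + r • L) + oseenSlice σ w w (x + r • L)) := funext fun r => hsplit _
    rw [hsplit x, e, intervalIntegral.integral_add ((hint p p M M hpc hpc hpM hpM).add (hint p w M S hpc hwc hpM hwS))
      ((hint w p S M hwc hpc hwS hpM).add (hint w w S S hwc hwc hwS hwS)),
      intervalIntegral.integral_add (hint p p M M hpc hpc hpM hpM) (hint p w M S hpc hwc hpM hwS),
      intervalIntegral.integral_add (hint w p S M hwc hpc hwS hpM) (hint w w S S hwc hwc hwS hwS)]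
    abel
  rw [hosc, hpp, zero_add]
  calc _ ≤ ‖oseenSlice σ p w x - ∫ r in (0:ℝ)..1, oseenSlice σ p w (x + r • L)‖ +
        (‖oseenSlice σ w p x - ∫ r in (0:ℝ)..1, oseenSlice σ w p (x + r • L)‖ +
         ‖oseenSlice σ w w x - ∫ r in (0:ℝ)..1, oseenSlice σ w w (x + r • L)‖) :=
        (norm_add_le _ _).trans (add_le_add le_rfl (norm_add_le _ _))
    _ ≤ κ * m * M * S + (κ * m * S * M + κ * m * (M + M) * S) := add_le_add h1 (add_le_add h2 h3)
    _ = 4 * κ * (m * M * S) := by ring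
    _ ≤ max (4 * κ) 1 * (m * M * S) :=
        mul_le_mul_of_nonneg_right (le_max_left _ _) (by positivity)
    _ = max (4 * κ) 1 * m * M * S := by ring

end Summit.NavierStokesRegularity.NavierStokesRegularity.Cruxes.HelicalEndLiouville.DRefute
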